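import Summits.KontsevichZagierPeriods.KontsevichZagierPeriods.Theorems.LogPrimitiveNL.Negative.DimZero
import Summits.KontsevichZagierPeriods.KontsevichZagierPeriods.Theorems.LogPrimitiveNL.Negative.BakerRelationSpan
import Summits.KontsevichZagierPeriods.KontsevichZagierPeriods.Theorems.GammaHodgeSector.Negative.Algebraicity
import Summits.KontsevichZagierPeriods.KontsevichZagierPeriods.Theorems.LiouvilleUnfoldingLogPrimitiveNLStubDescentCells
import Literature.NumberTheory.Transcendental.KZLogCalculusProofs
import HarnessLib

/-!
# The constant block of the structure theorem
(stub `stub_constBlockDescent`, line `ax-schanuel-germs`, crux `LiouvilleUnfolding.LogPrimitiveNL`,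
stmt-KontsevichZagierPeriods-2836)

On an open `C ⊆ ℝⁿ`, an identity `Σ_r q_r(x) log θ_r = g(x)` with positive real ALGEBRAIC numbers
`θ_r`, continuous `ℚ`-semialgebraic `q_r` and a `ℚ`-semialgebraic `g` forces, at every point
`x ∈ C`, the coefficient vector `(q_r x)_r` into the real span of the integer multiplicative
relations `{m ∈ ℤᴿ | ∏ θ_r ^ m_r = 1}`.

Proof.
* At a RATIONAL point `x ∈ C` the values `q_r x`, `g x` are algebraic
  (`GammaHodgeSectorNegative.isAlgebraic_apply_ratCast`); complexifying (`e^{log θ_r} = θ_r`),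
  Baker's inhomogeneous corollary `Negative.baker_sum_eq_zero` gives `g x = 0`, and Baker in
  relation-span form `Negative.baker_relation_span_int` writes `(q_r x)_r = Σ_s β_s m_s` with
  `m_s ∈ ℤᴿ`, `Σ_r (m_s r) log θ_r = 0` (i.e. `∏ θ_r ^ (m_s r) = 1`, `constBlock_prod_zpow_eq_one`)
  and `β_s ∈ ℚ̄ ⊆ ℂ`; taking real parts, `(q_r x)_r = Σ_s Re(β_s) m_s` lies in the span
  (`constBlock_mem_span_ratCast`).
* The span is closed (`Submodule.closed_of_finiteDimensional`) and `x ↦ (q_r x)_r` is continuous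
  on the open `C`, so the open set `C ∩ {x | (q_r x)_r ∉ span}`, if nonempty, would contain a
  rational point (`descent_exists_ratCast_mem`) — a contradiction.

The hypothesis `IsSemialgebraic ℚ C` of the registered signature is not used.
-/

noncomputable section

open Set MeasureTheory Filter
open scoped ContDiff Topology LaurentSeries RatFunc
open Literature.NumberTheory.Transcendental Literature.ModelTheory.ExponentialFields

namespace Summit.KontsevichZagierPeriods.LiouvilleUnfolding.LogPrimitiveNL.AxSchanuelGerms

/-- **An integer log-relation among positive reals is a multiplicative relation**: for positive
reals `θ_r` and integers `m_r`, the relation `Σ_r m_r log θ_r = 0` (read in `ℂ`) gives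
`∏ θ_r ^ m_r = 1`. [folklore] -/
theorem constBlock_prod_zpow_eq_one {R : ℕ} (θ : Fin R → ℝ) (hpos : ∀ r, 0 < θ r) (m : Fin R → ℤ)
    (hm : ∑ r, (m r : ℂ) * ((Real.log (θ r) : ℝ) : ℂ) = 0) : ∏ r, θ r ^ (m r) = 1 := by
  have hmR : ∑ r, (m r : ℝ) * Real.log (θ r) = 0 := by
    apply Complex.ofReal_injective
    rw [Complex.ofReal_zero, ← hm]
    push_cast
    rfl
  have hprodpos : 0 < ∏ r, θ r ^ (m r) := Finset.prod_pos fun r _ => zpow_pos (hpos r) _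
  refine Real.eq_one_of_pos_of_log_eq_zero hprodpos ?_
  rw [Real.log_prod (fun r _ => (zpow_pos (hpos r) _).ne'), ← hmR]
  exact Finset.sum_congr rfl fun r _ => Real.log_zpow _ _

/-- **The constant block at a rational point** (Baker): if `ℚ`-semialgebraic `q_r`, `g` on `C`
satisfy `Σ_r q_r(x) log θ_r = g(x)` at a RATIONAL point `x ∈ C`, with positive real algebraic
`θ_r`, then `(q_r x)_r ∈ span_ℝ {m ∈ ℤᴿ | ∏ θ_r ^ m_r = 1}`: the values `q_r x`, `g x` are
algebraic (`isAlgebraic_apply_ratCast`), so `g x = 0` by the inhomogeneous Baker corollary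
(`Negative.baker_sum_eq_zero`, Baker 1975 Thm. 2.1) and `(q_r x)_r` is a `ℚ̄`-combination of
integer relations (`Negative.baker_relation_span_int`); take real parts. -/
theorem constBlock_mem_span_ratCast {n R : ℕ} {C : Set (Fin n → ℝ)}
    {q : Fin R → (Fin n → ℝ) → ℝ} {g : (Fin n → ℝ) → ℝ} {θ : Fin R → ℝ}
    (hq : ∀ r, IsSemialgebraicFunOn ℚ C (q r)) (hg : IsSemialgebraicFunOn ℚ C g)
    (hθalg : ∀ r, IsAlgebraic ℚ (θ r)) (hθpos : ∀ r, 0 < θ r) (z : Fin n → ℚ)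
    (hz : (fun i => (z i : ℝ)) ∈ C)
    (hsum : ∑ r, q r (fun i => (z i : ℝ)) * Real.log (θ r) = g fun i => (z i : ℝ)) :
    (fun r => q r fun i => (z i : ℝ)) ∈ Submodule.span ℝ
      {φ : Fin R → ℝ | ∃ m : Fin R → ℤ, ∏ r, θ r ^ (m r) = 1 ∧ φ = fun r => (m r : ℝ)} := by
  set x : Fin n → ℝ := fun i => (z i : ℝ) with hxdef
  have hqalg : ∀ r, IsAlgebraic ℚ (q r x) := fun r =>
    GammaHodgeSectorNegative.isAlgebraic_apply_ratCast (hq r) z hz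
  have hgalg : IsAlgebraic ℚ (g x) := GammaHodgeSectorNegative.isAlgebraic_apply_ratCast hg z hz
  -- complexify
  set l : Fin R → ℂ := fun r => ((Real.log (θ r) : ℝ) : ℂ) with hldef
  set c : Fin R → ℂ := fun r => ((q r x : ℝ) : ℂ) with hcdef
  have halg : ∀ r, IsAlgebraic ℚ (Complex.exp (l r)) := fun r => by
    rw [hldef, ← Complex.ofReal_exp, Real.exp_log (hθpos r)]
    exact (hθalg r).algebraMap
  have hc : ∀ r, IsAlgebraic ℚ (c r) := fun r => (hqalg r).algebraMap
  have hsumC : ∑ r, c r * l r = ((g x : ℝ) : ℂ) := by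
    rw [← hsum]
    push_cast
    rfl
  have hg0 : ((g x : ℝ) : ℂ) = 0 :=
    Negative.baker_sum_eq_zero l c _ halg hc hgalg.algebraMap hsumC
  obtain ⟨R', m, β, -, hm, hcm⟩ :=
    Negative.baker_relation_span_int l c halg hc (hsumC.trans hg0)
  -- real parts
  have hre : (fun r => q r x) = ∑ s, (β s).re • (fun r => (m s r : ℝ)) := by
    funext r
    have h := congrArg Complex.re (hcm r)
    simp only [hcdef, Complex.ofReal_re, Complex.re_sum, Complex.mul_re, Complex.intCast_re,
      Complex.intCast_im, mul_zero, sub_zero] at h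
    rw [h]
    simp only [Finset.sum_apply, Pi.smul_apply, smul_eq_mul]
  rw [hre]
  refine Submodule.sum_mem _ fun s _ => Submodule.smul_mem _ _ (Submodule.subset_span ?_)
  exact ⟨m s, constBlock_prod_zpow_eq_one θ hθpos (m s) (hm s), rfl⟩

/-- **Constant block** (Baker, relation-span form, spread over an open cell): on an open
`ℚ`-semialgebraic `C`, if continuous `ℚ`-semialgebraic `q_r` and a `ℚ`-semialgebraic `g` satisfy
`Σ_r q_r(x) log θ_r = g(x)` with positive ALGEBRAIC numbers `θ_r`, then at every point `q(x)`
lies in the real span of the integer relation lattice `{m ∈ ℤᴿ | Π θ_r^{m_r} = 1}` (at rational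
points the values are algebraic and `baker_relation_span_int` applies — real parts of the
`ℚ̄`-coefficients, `constBlock_mem_span_ratCast`; rational points are dense in the open `C`
(`descent_exists_ratCast_mem`), `x ↦ (q_r x)_r` is continuous on `C` and the span is closed
(`Submodule.closed_of_finiteDimensional`)). -/
theorem stub_constBlockDescent :
    ∀ (n R : ℕ) (C : Set (Fin n → ℝ)) (q : Fin R → (Fin n → ℝ) → ℝ) (g : (Fin n → ℝ) → ℝ)
      (θ : Fin R → ℝ), IsSemialgebraic ℚ C → IsOpen C →
      (∀ r, IsSemialgebraicFunOn ℚ C (q r)) → (∀ r, ContinuousOn (q r) C) →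
      IsSemialgebraicFunOn ℚ C g → (∀ r, IsAlgebraic ℚ (θ r)) → (∀ r, 0 < θ r) →
      (∀ x ∈ C, ∑ r, q r x * Real.log (θ r) = g x) →
      ∀ x ∈ C, (fun r => q r x) ∈ Submodule.span ℝ
        {φ : Fin R → ℝ | ∃ m : Fin R → ℤ, ∏ r, θ r ^ (m r) = 1 ∧ φ = fun r => (m r : ℝ)} := by
  intro n R C q g θ _ hCo hq hqc hg hθalg hθpos hsum x hx
  set S : Submodule ℝ (Fin R → ℝ) := Submodule.span ℝ
    {φ : Fin R → ℝ | ∃ m : Fin R → ℤ, ∏ r, θ r ^ (m r) = 1 ∧ φ = fun r => (m r : ℝ)} with hSdef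
  by_contra hnot
  have hS : IsClosed (S : Set (Fin R → ℝ)) := Submodule.closed_of_finiteDimensional S
  have hQ : ContinuousOn (fun y => fun r => q r y) C := continuousOn_pi.2 hqc
  have hO : IsOpen (C ∩ (fun y => fun r => q r y) ⁻¹' (S : Set (Fin R → ℝ))ᶜ) :=
    hQ.isOpen_inter_preimage hCo hS.isOpen_compl
  obtain ⟨z, hzC, hz⟩ := descent_exists_ratCast_mem hO (x := x) ⟨hx, hnot⟩
  exact hz (constBlock_mem_span_ratCast hq hg hθalg hθpos z hzC (hsum _ hzC))

end Summit.KontsevichZagierPeriods.LiouvilleUnfolding.LogPrimitiveNL.AxSchanuelGerms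

end
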